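import Summits.KontsevichZagierPeriods.KontsevichZagierPeriods.Theorems.StuffleInKZ.Negative.Core

/-!
# Sub-polynomially divergent functions satisfy no polynomial identity (growth transcendence)

Support lemma for the cdisprove unit of `StuffleInKZ` (stmt-KontsevichZagierPeriods-3931), cycle 3,
Part II (`ChangeOfVariablesNecessary.lean`): a function `ρ` on a left neighbourhood of `1` with
`ρ(s) → −∞` but `(1 − s) ρ(s)^k → 0` for every `k ≥ 1` (e.g. `ρ ∼ −c·log(1/(1−s))`) satisfies no
identity `P(s, ρ(s)) = 0` with `0 ≠ P ∈ ℝ[X][Y]` (`eq_zero_of_evalEval_of_subpolynomial`).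

Proof (dominant balance): if every coefficient `p_j` of `P` vanishes at `1`, divide them all by
`X − 1` (this lowers `Σ_j deg p_j`, the induction measure); otherwise let `j*` be the LARGEST `j`
with `p_j(1) ≠ 0` and divide the identity by `ρ^{j*}`: the term `j = j*` tends to `p_{j*}(1) ≠ 0`,
the terms `j < j*` tend to `0` because `|ρ| → ∞`, and the terms `j > j*` have `p_j = (X − 1) r_j`,
so they tend to `0` because `(1 − s) ρ^{j − j*} → 0`.

Elementary real analysis; [folklore].
-/

noncomputable section

namespace Summit.KontsevichZagierPeriods.Theorems.StuffleInKZ.Negative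

namespace Growth

open Filter Set Polynomial
open scoped Topology Polynomial.Bivariate

/-- `P(s, y) = Σ_{j ≤ deg P} p_j(s) y^j`. [folklore] -/
theorem evalEval_eq_sum_range (P : ℝ[X][Y]) (s y : ℝ) :
    P.evalEval s y = ∑ j ∈ Finset.range (P.natDegree + 1), (P.coeff j).eval s * y ^ j := by
  conv_lhs => rw [P.as_sum_range_C_mul_X_pow]
  simp [evalEval_finsetSum, evalEval_C]

/-- If every coefficient of `P` vanishes at `a`, then `P = C (X − C a) * Q`. [folklore] -/
theorem exists_eq_C_mul_of_forall_eval_eq_zero {P : ℝ[X][Y]} {a : ℝ}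
    (h : ∀ j, (P.coeff j).eval a = 0) : ∃ Q : ℝ[X][Y], P = C (X - C a) * Q := by
  have hdvd : C (X - C a) ∣ P := by
    rw [C_dvd_iff_dvd_coeff]
    intro j
    exact dvd_iff_isRoot.mpr (h j)
  exact hdvd

/-- The induction measure: total degree of the coefficients. -/
def coeffDegSum (P : ℝ[X][Y]) : ℕ := ∑ j ∈ Finset.range (P.natDegree + 1), (P.coeff j).natDegree

/-- Dividing all coefficients by `X − a` strictly lowers the measure (if `P ≠ 0`). [folklore] -/
theorem coeffDegSum_lt {P Q : ℝ[X][Y]} {a : ℝ} (hP : P ≠ 0) (hPQ : P = C (X - C a) * Q) :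
    coeffDegSum Q < coeffDegSum P := by
  have hXa : (X - C a : ℝ[X]) ≠ 0 := X_sub_C_ne_zero a
  have hQ : Q ≠ 0 := by rintro rfl; exact hP (by simp [hPQ])
  have hcoeff : ∀ j, P.coeff j = (X - C a) * Q.coeff j := fun j => by rw [hPQ, coeff_C_mul]
  have hdeg : P.natDegree = Q.natDegree := by
    rw [hPQ, natDegree_C_mul]
    exact hXa
  have hle : ∀ j, (Q.coeff j).natDegree + (if Q.coeff j = 0 then 0 else 1) = (P.coeff j).natDegree := by
    intro j
    by_cases hj : Q.coeff j = 0
    · simp [hcoeff j, hj]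
    · rw [if_neg hj, hcoeff j, natDegree_mul hXa hj, natDegree_X_sub_C]
      ring
  unfold coeffDegSum
  rw [hdeg]
  have hlt : ∑ j ∈ Finset.range (Q.natDegree + 1), (Q.coeff j).natDegree <
      ∑ j ∈ Finset.range (Q.natDegree + 1),
        ((Q.coeff j).natDegree + if Q.coeff j = 0 then 0 else 1) := by
    apply Finset.sum_lt_sum (fun j _ => Nat.le_add_right _ _)
    refine ⟨Q.natDegree, Finset.self_mem_range_succ _, ?_⟩
    have hlc : Q.coeff Q.natDegree ≠ 0 := leadingCoeff_ne_zero.mpr hQ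
    rw [if_neg hlc]
    omega
  calc ∑ j ∈ Finset.range (Q.natDegree + 1), (Q.coeff j).natDegree
      < ∑ j ∈ Finset.range (Q.natDegree + 1),
          ((Q.coeff j).natDegree + if Q.coeff j = 0 then 0 else 1) := hlt
    _ = ∑ j ∈ Finset.range (Q.natDegree + 1), (P.coeff j).natDegree :=
        Finset.sum_congr rfl fun j _ => hle j

/-- **Dominant balance / division step.** Given the induction hypothesis `rec` for all `Q` of
smaller measure, a `P` with `P(s, ρ s) = 0` eventually (as `s → 1⁻`) vanishes. [folklore] -/
theorem step {ρ : ℝ → ℝ} {l : Filter ℝ} [l.NeBot] (hl : l ≤ 𝓝[<] (1 : ℝ))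
    (hbot : Tendsto ρ l atBot)
    (hsub : ∀ k : ℕ, 1 ≤ k → Tendsto (fun s => (1 - s) * ρ s ^ k) l (𝓝 0))
    (P : ℝ[X][Y])
    (rec : ∀ Q : ℝ[X][Y], (∀ᶠ s in l, Q.evalEval s (ρ s) = 0) →
      coeffDegSum Q < coeffDegSum P → Q = 0)
    (hP : ∀ᶠ s in l, P.evalEval s (ρ s) = 0) : P = 0 := by
  have hl1 : Tendsto (fun s : ℝ => s) l (𝓝 1) :=
    tendsto_id.mono_left (hl.trans nhdsWithin_le_nhds)
  have hlt1 : ∀ᶠ s in l, s < 1 := hl self_mem_nhdsWithin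
  by_contra hP0
  by_cases hall : ∀ j, (P.coeff j).eval 1 = 0
  · -- divide by X - 1
    obtain ⟨Q, hPQ⟩ := exists_eq_C_mul_of_forall_eval_eq_zero hall
    have hQ : ∀ᶠ s in l, Q.evalEval s (ρ s) = 0 := by
      filter_upwards [hP, hlt1] with s hs hs1
      rw [hPQ, evalEval_mul, evalEval_C, eval_sub, eval_X, eval_C] at hs
      have hne : s - 1 ≠ 0 := sub_ne_zero.mpr (ne_of_lt hs1)
      exact (mul_eq_zero.mp hs).resolve_left (by exact hne)
    have hQ0 : Q = 0 := rec Q hQ (coeffDegSum_lt hP0 hPQ)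
    exact hP0 (by rw [hPQ, hQ0, mul_zero])
  · -- dominant balance
    push Not at hall
    classical
    set d := P.natDegree with hd
    set J := (Finset.range (d + 1)).filter fun j => (P.coeff j).eval 1 ≠ 0 with hJ
    have hJne : J.Nonempty := by
      obtain ⟨j, hj⟩ := hall
      refine ⟨j, Finset.mem_filter.mpr ⟨Finset.mem_range.mpr ?_, hj⟩⟩
      by_contra hjd
      push Not at hjd
      have : P.coeff j = 0 := coeff_eq_zero_of_natDegree_lt (by omega)
      exact hj (by simp [this])
    set js := J.max' hJne with hjs
    have hjs_mem : js ∈ J := Finset.max'_mem J hJne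
    have hjs_ne : (P.coeff js).eval 1 ≠ 0 := (Finset.mem_filter.mp hjs_mem).2
    have hjs_le : js ≤ d := Nat.lt_succ_iff.mp (Finset.mem_range.mp (Finset.mem_filter.mp hjs_mem).1)
    have hgt : ∀ j ∈ Finset.range (d + 1), js < j → (P.coeff j).eval 1 = 0 := by
      intro j hj hlt
      by_contra hne
      have : j ≤ js := Finset.le_max' J j (Finset.mem_filter.mpr ⟨hj, hne⟩)
      omega
    -- for j > js write p_j = (X - 1) * r_j
    have hr : ∀ j ∈ Finset.range (d + 1), js < j → ∃ r : ℝ[X], P.coeff j = (X - C 1) * r :=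
      fun j hj hlt => dvd_iff_isRoot.mpr (hgt j hj hlt)
    choose! r hr using hr
    -- eventually ρ s < 0, in particular ρ s ≠ 0
    have hneg : ∀ᶠ s in l, ρ s < 0 := hbot.eventually (eventually_lt_atBot 0)
    -- the normalised terms and their limits
    let T : ℕ → ℝ → ℝ := fun j s => (P.coeff j).eval s * ρ s ^ j * (ρ s)⁻¹ ^ js
    have hlim : ∀ j ∈ Finset.range (d + 1),
        Tendsto (T j) l (𝓝 (if j = js then (P.coeff js).eval 1 else 0)) := by
      intro j hj
      have hpj : Tendsto (fun s => (P.coeff j).eval s) l (𝓝 ((P.coeff j).eval 1)) :=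
        ((P.coeff j).continuous.tendsto 1).comp hl1
      have hinv : Tendsto (fun s => (ρ s)⁻¹) l (𝓝 0) := hbot.inv_tendsto_atBot
      rcases lt_trichotomy j js with hlt | heq | hgt'
      · -- j < js : T j s = p_j(s) * (ρ s)⁻¹ ^ (js - j) eventually
        rw [if_neg hlt.ne]
        have hev : ∀ᶠ s in l, T j s = (P.coeff j).eval s * (ρ s)⁻¹ ^ (js - j) := by
          filter_upwards [hneg] with s hs
          have hρ : ρ s ≠ 0 := hs.ne
          simp only [T]
          calc (P.coeff j).eval s * ρ s ^ j * (ρ s)⁻¹ ^ js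
              = (P.coeff j).eval s * ρ s ^ j * ((ρ s)⁻¹ ^ j * (ρ s)⁻¹ ^ (js - j)) := by
                rw [← pow_add, Nat.add_sub_cancel' hlt.le]
            _ = (P.coeff j).eval s * (ρ s ^ j * (ρ s)⁻¹ ^ j) * (ρ s)⁻¹ ^ (js - j) := by ring
            _ = (P.coeff j).eval s * (ρ s)⁻¹ ^ (js - j) := by
                rw [inv_pow, mul_inv_cancel₀ (pow_ne_zero _ hρ), mul_one]
        refine Tendsto.congr' (EventuallyEq.symm hev) ?_
        have := hpj.mul (hinv.pow (js - j))
        rwa [zero_pow (by omega), mul_zero] at this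
      · -- j = js
        rw [if_pos heq, ← heq]
        have hev : ∀ᶠ s in l, T j s = (P.coeff j).eval s := by
          filter_upwards [hneg] with s hs
          have hρ : ρ s ≠ 0 := hs.ne
          simp only [T]
          rw [← heq, inv_pow, mul_assoc, mul_inv_cancel₀ (pow_ne_zero _ hρ), mul_one]
        exact Tendsto.congr' (EventuallyEq.symm hev) hpj
      · -- j > js : T j s = -(r_j s) * ((1 - s) * ρ s ^ (j - js)) eventually
        rw [if_neg hgt'.ne']
        have hrj := hr j hj hgt'
        have hev : ∀ᶠ s in l,
            T j s = -(r j).eval s * ((1 - s) * ρ s ^ (j - js)) := by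
          filter_upwards [hneg] with s hs
          have hρ : ρ s ≠ 0 := hs.ne
          simp only [T]
          rw [hrj, eval_mul, eval_sub, eval_X, eval_C]
          calc (s - 1) * (r j).eval s * ρ s ^ j * (ρ s)⁻¹ ^ js
              = (s - 1) * (r j).eval s * (ρ s ^ js * ρ s ^ (j - js)) * (ρ s)⁻¹ ^ js := by
                rw [← pow_add, Nat.add_sub_cancel' hgt'.le]
            _ = (s - 1) * (r j).eval s * ρ s ^ (j - js) * (ρ s ^ js * (ρ s)⁻¹ ^ js) := by ring
            _ = -(r j).eval s * ((1 - s) * ρ s ^ (j - js)) := by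
                rw [inv_pow, mul_inv_cancel₀ (pow_ne_zero _ hρ), mul_one]
                ring
        refine Tendsto.congr' (EventuallyEq.symm hev) ?_
        have hrt : Tendsto (fun s => -(r j).eval s) l (𝓝 (-(r j).eval 1)) :=
          (((r j).continuous.tendsto 1).comp hl1).neg
        have := hrt.mul (hsub (j - js) (by omega))
        rwa [mul_zero] at this
    -- sum of the limits
    have hsum : Tendsto (fun s => ∑ j ∈ Finset.range (d + 1), T j s) l
        (𝓝 (∑ j ∈ Finset.range (d + 1), if j = js then (P.coeff js).eval 1 else 0)) :=
      tendsto_finsetSum _ hlim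
    rw [Finset.sum_ite_eq' (Finset.range (d + 1)) js, if_pos (Finset.mem_range.mpr (by omega))]
      at hsum
    -- but the sum is eventually 0
    have hzero : ∀ᶠ s in l, ∑ j ∈ Finset.range (d + 1), T j s = 0 := by
      filter_upwards [hP] with s hs
      have : ∑ j ∈ Finset.range (d + 1), T j s =
          (∑ j ∈ Finset.range (d + 1), (P.coeff j).eval s * ρ s ^ j) * (ρ s)⁻¹ ^ js := by
        rw [Finset.sum_mul]
      rw [this, ← evalEval_eq_sum_range, hs, zero_mul]
    have h0 : Tendsto (fun s => ∑ j ∈ Finset.range (d + 1), T j s) l (𝓝 0) :=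
      tendsto_const_nhds.congr' (EventuallyEq.symm hzero)
    exact hjs_ne (tendsto_nhds_unique hsum h0)

/-- **Growth transcendence.** Along any non-trivial filter `l ≤ 𝓝[<] 1` (e.g. `𝓝[<] 1` itself,
or its restriction to a set of full measure near `1`): if `ρ s → −∞` and `(1 − s) ρ(s)^k → 0` for
all `k ≥ 1` along `l`, then no non-zero `P ∈ ℝ[X][Y]` has `P(s, ρ s) = 0` `l`-eventually. [folklore] -/
theorem eq_zero_of_evalEval_of_subpolynomial {ρ : ℝ → ℝ} {l : Filter ℝ} [l.NeBot]
    (hl : l ≤ 𝓝[<] (1 : ℝ)) (hbot : Tendsto ρ l atBot)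
    (hsub : ∀ k : ℕ, 1 ≤ k → Tendsto (fun s => (1 - s) * ρ s ^ k) l (𝓝 0)) :
    ∀ P : ℝ[X][Y], (∀ᶠ s in l, P.evalEval s (ρ s) = 0) → P = 0 := by
  suffices H : ∀ N : ℕ, ∀ P : ℝ[X][Y], coeffDegSum P ≤ N →
      (∀ᶠ s in l, P.evalEval s (ρ s) = 0) → P = 0 from
    fun P hP => H _ P le_rfl hP
  intro N
  induction N with
  | zero =>
    intro P hN hP
    exact step hl hbot hsub P (fun Q _ hlt => absurd hlt (by omega)) hP
  | succ N ih =>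
    intro P hN hP
    exact step hl hbot hsub P (fun Q hQ hlt => ih Q (by omega) hQ) hP

end Growth

end Summit.KontsevichZagierPeriods.Theorems.StuffleInKZ.Negative
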